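import Summits.CriticalPhenomena.PercolationContinuityZ3.Theorems.PercNearOneGluingNoHeavyLowerTailChampionEdgeStep
import Summits.CriticalPhenomena.PercolationContinuityZ3.Theorems.PercNearOneGluingAdditiveGluingKnThm2GoodEvents
import HarnessLib

/-!
# `NoHeavyLowerTail` (stmt-CriticalPhenomena-4575) — the ROOTED EXCHANGE: the two-sided kernel (DC) when both observers are glued,
# from van den Berg–Häggström–Kahn's conditional association

Support file (prover `prim-hp-3`, hull-port line; `--supports stmt-CriticalPhenomena-4575`).  No definitions, no named facts, no sorries.

Notation: `μ_w = prodBernoulli w` on `Fin n`, relays `A`, level `j`, `π(x) = {z ∈ A : x ↔ z}`, `I_w(x) = μ_w{|π(x)| ≤ j}`, `R_x = {|π(x)| ≤ j}`; for an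
observer set `O` the E-mass `E_w(v) = μ_w(v ↮ O, 1 ≤ |π(O)| ≤ j) + μ_w(v ↔ O, |π(v)| ≤ j)`.

* `HullPort.coreExchange` — **three-vertex exchange** (pure percolation, any weights): if `p ≠ t` and `I(p) ≤ I(t)` then for every vertex `v`
  `μ(p ↮ t, p ↔ v, R_p, ¬R_t) ≤ μ(p ↮ t, p ↔ v, R_t, ¬R_p)`:
  given that `v` hangs on the cluster of `p` and the clusters of `p, t` are disjoint, "`p` lonely and `t` not" is at most as likely as "`t` lonely and
  `p` not".  Proof: BHK 2006 Thm 1.5 in the event form `twoClusterExchange` for the pair `(p,t)` with `A₁ = {p ↔ v}` (type `+`), `B₁ = R_p ∩ R_tᶜ`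
  (type `−`), `A₂ = R_t ∩ R_pᶜ` (type `+`), `B₂ = ⊤`, and the base comparison `μ(p ↮ t, R_p) ≤ μ(p ↮ t, R_t)`, which is `I(p) ≤ I(t)` because the
  two loneliness events agree on `{p ↔ t}` (`CutObserver.lightness_sub_eq_sep`).
* `HullPort.obsE_le_of_doublyGlued` — **(DC) for two glued observers**: `O = {o, o'}`, `w s(o,t) = 1`, `w s(o',p) = 1`, `p ≠ t`, and `I(p) ≤ I(t)`.
  Then `E_w(v) ≤ I_w(t)` for EVERY vertex `v` (light or heavy).  Bookkeeping: a.s. `C_o = C_t`, `C_{o'} = C_p`; the part of the E-event of `v` not inside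
  `R_t` is exactly the left event of `coreExchange`, and its right event lies in `R_t` outside the E-event.
WHY (crux notes `HULLPORT-REF-gen6.md` §15–16): in the (DC) induction (`dc_of_outsiderStepAll`) the faces reached by deleting the pairs of the second
observer one at a time and gluing the next one are doubly glued; with the champion-edge step (`…ChampionEdgeStep`) this proves the outsider step for every
`v` whenever the glued champion dominates the other star's ports along such an order (98 % of dominated rooted instances, seat census), in particular the
GLUED-CHAMPION residual; it is the first proof of a (DC) statement for LIGHT outsiders (`I(v) > I(t)`), where the observer-set lemma (`setCS_deficit_le_excess`)
is void.
-/

noncomputable section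

namespace Summit.CriticalPhenomena.PercolationContinuityZ3.Theorems

open MeasureTheory Set Literature.Probability.LatticeModels Literature.Probability.Percolation
open scoped Classical BigOperators

variable {n : ℕ}

namespace HullPort

/-- Joined vertices have the same relay set. [folklore] -/
theorem filter_openConn_eq_of_reachable (A : Finset (Fin n)) {x y : Fin n} {ω : BondConfig (Fin n)}
    (h : (openGraph ω).Reachable x y) :
    (A.filter fun z => ω ∈ openConn x z) = (A.filter fun z => ω ∈ openConn y z) := by
  apply Finset.filter_congr
  intro z _
  change (openGraph ω).Reachable x z ↔ (openGraph ω).Reachable y z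
  exact ⟨fun hz => h.symm.trans hz, fun hz => h.trans hz⟩

/-- **Three-vertex exchange.**  `p ≠ t`, `I(p) ≤ I(t)`: for every `v`,
`μ(p ↮ t, p ↔ v, |π(p)| ≤ j, |π(t)| > j) ≤ μ(p ↮ t, p ↔ v, |π(t)| ≤ j, |π(p)| > j)`.
[cite: VandenbergHaggstromKahn2005, Thm. 1.5 (p. 7) — via `twoClusterExchange`; this work] -/
theorem coreExchange (w : Sym2 (Fin n) → unitInterval) (A : Finset (Fin n)) (p t v : Fin n) (j : ℕ) (hpt : p ≠ t)
    (hle : (prodBernoulli w).real {ω : BondConfig (Fin n) | (A.filter fun z => ω ∈ openConn p z).card ≤ j} ≤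
      (prodBernoulli w).real {ω : BondConfig (Fin n) | (A.filter fun z => ω ∈ openConn t z).card ≤ j}) :
    (prodBernoulli w).real ((openConn p t : Set (BondConfig (Fin n)))ᶜ ∩ ((openConn p v : Set (BondConfig (Fin n))) ∩
        ({ω : BondConfig (Fin n) | (A.filter fun z => ω ∈ openConn p z).card ≤ j} ∩
          {ω : BondConfig (Fin n) | (A.filter fun z => ω ∈ openConn t z).card ≤ j}ᶜ))) ≤
      (prodBernoulli w).real ((openConn p t : Set (BondConfig (Fin n)))ᶜ ∩ ((openConn p v : Set (BondConfig (Fin n))) ∩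
        ({ω : BondConfig (Fin n) | (A.filter fun z => ω ∈ openConn t z).card ≤ j} ∩
          {ω : BondConfig (Fin n) | (A.filter fun z => ω ∈ openConn p z).card ≤ j}ᶜ))) := by
  set μ := prodBernoulli w with hμ
  set D : Set (BondConfig (Fin n)) := (openConn p t : Set (BondConfig (Fin n)))ᶜ with hD
  set Rp := {ω : BondConfig (Fin n) | (A.filter fun z => ω ∈ openConn p z).card ≤ j} with hRp
  set Rt := {ω : BondConfig (Fin n) | (A.filter fun z => ω ∈ openConn t z).card ≤ j} with hRt
  set X : Set (BondConfig (Fin n)) := (openConn p v : Set (BondConfig (Fin n))) with hX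
  have hmeas : ∀ S : Set (BondConfig (Fin n)), MeasurableSet S := fun S => (Set.toFinite S).measurableSet
  -- the exchange (BHK Thm 1.5, event form) for the pair `(p, t)`
  have key := twoClusterExchange w hpt (A₁ := X) (A₂ := Rt ∩ Rpᶜ) (B₁ := Rp ∩ Rtᶜ) (B₂ := (univ : Set (BondConfig (Fin n))))
    (fun ω ω' hs ht hω => typePlus_openConn p t v hs ht hω)
    (fun ω ω' hs ht hω => ⟨LonelyClusterExchange.typePlus_card_le A j p t hs ht hω.1,
      fun h' => hω.2 (LonelyClusterExchange.typeMinus_card_le A j p t hs ht h')⟩)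
    (fun ω ω' hs ht hω => ⟨LonelyClusterExchange.typeMinus_card_le A j p t hs ht hω.1,
      fun h' => hω.2 (LonelyClusterExchange.typePlus_card_le A j p t hs ht h')⟩)
    (fun _ _ _ _ _ => mem_univ _)
  simp only [inter_univ] at key
  -- the base comparison `μ(D ∩ Rp) ≤ μ(D ∩ Rt)` from `I(p) ≤ I(t)`
  have hsep := CutObserver.lightness_sub_eq_sep w A p t j
  -- `μ(Rp) - μ(Rt) = μ((openConn t p)ᶜ ∩ Rp) - μ((openConn t p)ᶜ ∩ Rt)`
  have hcomm : (openConn t p : Set (BondConfig (Fin n))) = openConn p t := knThm2_openConn_comm t p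
  rw [hcomm] at hsep
  have hbase : μ.real (D ∩ Rp) ≤ μ.real (D ∩ Rt) := by
    have : μ.real Rp - μ.real Rt ≤ 0 := by linarith
    linarith
  -- split `D ∩ Rp` and `D ∩ Rt` along the other loneliness event
  have h1 : μ.real (D ∩ Rp ∩ Rt) + μ.real ((D ∩ Rp) \ Rt) = μ.real (D ∩ Rp) := measureReal_inter_add_sdiff (hmeas Rt)
  have h2 : μ.real (D ∩ Rt ∩ Rp) + μ.real ((D ∩ Rt) \ Rp) = μ.real (D ∩ Rt) := measureReal_inter_add_sdiff (hmeas Rp)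
  have e12 : D ∩ Rp ∩ Rt = D ∩ Rt ∩ Rp := by ext ω; simp only [mem_inter_iff]; tauto
  have eB : (D ∩ Rp) \ Rt = D ∩ (Rp ∩ Rtᶜ) := by ext ω; simp only [mem_inter_iff, mem_sdiff, mem_compl_iff]; tauto
  have eA : (D ∩ Rt) \ Rp = D ∩ (Rt ∩ Rpᶜ) := by ext ω; simp only [mem_inter_iff, mem_sdiff, mem_compl_iff]; tauto
  rw [e12] at h1
  rw [eB] at h1
  rw [eA] at h2
  have hdb : μ.real (D ∩ (Rp ∩ Rtᶜ)) ≤ μ.real (D ∩ (Rt ∩ Rpᶜ)) := by linarith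
  -- the left event lies in `D ∩ (Rp ∩ Rtᶜ)`
  have hsub : μ.real (D ∩ (X ∩ (Rp ∩ Rtᶜ))) ≤ μ.real (D ∩ (Rp ∩ Rtᶜ)) :=
    measureReal_mono (fun ω hω => ⟨hω.1, hω.2.2⟩) (measure_ne_top _ _)
  have hnn : 0 ≤ μ.real (D ∩ (X ∩ (Rt ∩ Rpᶜ))) := measureReal_nonneg
  by_cases hb : μ.real (D ∩ (Rt ∩ Rpᶜ)) = 0
  · have h0 : μ.real (D ∩ (Rp ∩ Rtᶜ)) ≤ 0 := by rw [hb] at hdb; exact hdb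
    linarith
  · have hbpos : 0 < μ.real (D ∩ (Rt ∩ Rpᶜ)) := lt_of_le_of_ne measureReal_nonneg (Ne.symm hb)
    -- `a·b ≤ c·d ≤ c·b` with `b > 0`
    have hcd : μ.real (D ∩ (X ∩ (Rt ∩ Rpᶜ))) * μ.real (D ∩ (Rp ∩ Rtᶜ)) ≤
        μ.real (D ∩ (X ∩ (Rt ∩ Rpᶜ))) * μ.real (D ∩ (Rt ∩ Rpᶜ)) := mul_le_mul_of_nonneg_left hdb hnn
    have hab := key.trans hcd
    exact le_of_mul_le_mul_right hab hbpos

/-- **(DC) for two glued observers.**  `o ≠ t`, `o' ≠ p`, `p ≠ t`, `w s(o,t) = 1`, `w s(o',p) = 1`, `I(p) ≤ I(t)`: for the observer set `{o, o'}` and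
every vertex `v`, `E_w(v) ≤ I_w(t)`.  [cite: VandenbergHaggstromKahn2005, Thm. 1.5 (p. 7) — via `coreExchange`; this work] -/
theorem obsE_le_of_doublyGlued (w : Sym2 (Fin n) → unitInterval) (A : Finset (Fin n)) (o o' p t v : Fin n) (j : ℕ)
    (hot : o ≠ t) (hop : o' ≠ p) (hpt : p ≠ t) (hwt : w s(o, t) = 1) (hwp : w s(o', p) = 1)
    (hle : (prodBernoulli w).real {ω : BondConfig (Fin n) | (A.filter fun z => ω ∈ openConn p z).card ≤ j} ≤
      (prodBernoulli w).real {ω : BondConfig (Fin n) | (A.filter fun z => ω ∈ openConn t z).card ≤ j}) :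
    (prodBernoulli w).real {ω : BondConfig (Fin n) | (∀ x ∈ ({o, o'} : Finset (Fin n)), ω ∉ openConn v x) ∧
        1 ≤ (A.filter fun z => ∃ x ∈ ({o, o'} : Finset (Fin n)), ω ∈ openConn x z).card ∧
        (A.filter fun z => ∃ x ∈ ({o, o'} : Finset (Fin n)), ω ∈ openConn x z).card ≤ j} +
      (prodBernoulli w).real {ω : BondConfig (Fin n) | (∃ x ∈ ({o, o'} : Finset (Fin n)), ω ∈ openConn v x) ∧
        (A.filter fun z => ω ∈ openConn v z).card ≤ j} ≤
      (prodBernoulli w).real {ω : BondConfig (Fin n) | (A.filter fun z => ω ∈ openConn t z).card ≤ j} := by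
  set μ := prodBernoulli w with hμ
  set O : Finset (Fin n) := {o, o'} with hO
  set X₁ := {ω : BondConfig (Fin n) | (∀ x ∈ O, ω ∉ openConn v x) ∧
        1 ≤ (A.filter fun z => ∃ x ∈ O, ω ∈ openConn x z).card ∧
        (A.filter fun z => ∃ x ∈ O, ω ∈ openConn x z).card ≤ j} with hX₁
  set X₂ := {ω : BondConfig (Fin n) | (∃ x ∈ O, ω ∈ openConn v x) ∧ (A.filter fun z => ω ∈ openConn v z).card ≤ j} with hX₂
  set Rp := {ω : BondConfig (Fin n) | (A.filter fun z => ω ∈ openConn p z).card ≤ j} with hRp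
  set Rt := {ω : BondConfig (Fin n) | (A.filter fun z => ω ∈ openConn t z).card ≤ j} with hRt
  set D : Set (BondConfig (Fin n)) := (openConn p t : Set (BondConfig (Fin n)))ᶜ with hD
  set Xv : Set (BondConfig (Fin n)) := (openConn p v : Set (BondConfig (Fin n))) with hXv
  set Leak : Set (BondConfig (Fin n)) := D ∩ (Xv ∩ (Rp ∩ Rtᶜ)) with hLeak
  set Room : Set (BondConfig (Fin n)) := D ∩ (Xv ∩ (Rt ∩ Rpᶜ)) with hRoom
  set G : Set (BondConfig (Fin n)) := {ω | s(o, t) ∈ ω} ∩ {ω | s(o', p) ∈ ω} with hG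
  have hmeas : ∀ S : Set (BondConfig (Fin n)), MeasurableSet S := fun S => (Set.toFinite S).measurableSet
  -- the good set has full measure
  have hG1 : μ.real {ω : BondConfig (Fin n) | s(o, t) ∈ ω}ᶜ = 0 := by
    have h := edgeSw_real_eq_of_sure w s(o, t) hwt ({ω : BondConfig (Fin n) | s(o, t) ∈ ω}ᶜ) ∅
      (fun ω he => by simp only [mem_compl_iff, mem_setOf_eq, mem_empty_iff_false, iff_false, not_not]; exact he)
    rw [h]; simp
  have hG2 : μ.real {ω : BondConfig (Fin n) | s(o', p) ∈ ω}ᶜ = 0 := by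
    have h := edgeSw_real_eq_of_sure w s(o', p) hwp ({ω : BondConfig (Fin n) | s(o', p) ∈ ω}ᶜ) ∅
      (fun ω he => by simp only [mem_compl_iff, mem_setOf_eq, mem_empty_iff_false, iff_false, not_not]; exact he)
    rw [h]; simp
  have hGc : μ.real Gᶜ = 0 := by
    have hsub : Gᶜ ⊆ {ω : BondConfig (Fin n) | s(o, t) ∈ ω}ᶜ ∪ {ω : BondConfig (Fin n) | s(o', p) ∈ ω}ᶜ := by
      intro ω hω
      simp only [hG, mem_compl_iff, mem_inter_iff, mem_setOf_eq, not_and_or] at hω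
      simp only [mem_union, mem_compl_iff, mem_setOf_eq]
      exact hω
    have h : μ.real Gᶜ ≤ μ.real ({ω : BondConfig (Fin n) | s(o, t) ∈ ω}ᶜ ∪ {ω : BondConfig (Fin n) | s(o', p) ∈ ω}ᶜ) :=
      measureReal_mono hsub (measure_ne_top _ _)
    have h' := h.trans (measureReal_union_le ({ω : BondConfig (Fin n) | s(o, t) ∈ ω}ᶜ) ({ω : BondConfig (Fin n) | s(o', p) ∈ ω}ᶜ))
    rw [hG1, hG2, add_zero] at h'
    exact le_antisymm h' measureReal_nonneg
  have hfull : ∀ S : Set (BondConfig (Fin n)), μ.real S ≤ μ.real (S ∩ G) := by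
    intro S
    have h1 : S ⊆ (S ∩ G) ∪ Gᶜ := by
      intro ω hω; by_cases hg : ω ∈ G
      · exact Or.inl ⟨hω, hg⟩
      · exact Or.inr hg
    have h : μ.real S ≤ μ.real ((S ∩ G) ∪ Gᶜ) := measureReal_mono h1 (measure_ne_top _ _)
    have h' := h.trans (measureReal_union_le (S ∩ G) Gᶜ)
    rw [hGc, add_zero] at h'
    exact h'
  -- reachability facts on the good set
  have hreach_ot : ∀ ω ∈ G, (openGraph ω).Reachable o t := by
    intro ω hω
    exact ((openGraph_adj ω o t).mpr ⟨hω.1, hot⟩).reachable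
  have hreach_op : ∀ ω ∈ G, (openGraph ω).Reachable o' p := by
    intro ω hω
    exact ((openGraph_adj ω o' p).mpr ⟨hω.2, hop⟩).reachable
  -- (1) `X₁ ∩ G ⊆ Rt`, and `X₁` is disjoint from `X₂` and from `Room`
  have hX1 : X₁ ∩ G ⊆ Rt ∩ X₁ := by
    rintro ω ⟨hω, hg⟩
    refine ⟨?_, hω⟩
    simp only [hRt, mem_setOf_eq]
    obtain ⟨-, -, hle'⟩ := hω
    refine le_trans (Finset.card_le_card ?_) hle'
    intro z hz
    rw [Finset.mem_filter] at hz ⊢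
    refine ⟨hz.1, o, by simp [hO], ?_⟩
    exact ((hreach_ot ω hg).trans (show (openGraph ω).Reachable t z from hz.2) : (openGraph ω).Reachable o z)
  -- (2) `X₂ ∩ G ⊆ (X₂ ∩ Rt) ∪ Leak`
  have hX2 : X₂ ∩ G ⊆ (X₂ ∩ Rt) ∪ Leak := by
    rintro ω ⟨hω, hg⟩
    by_cases ht : ω ∈ Rt
    · exact Or.inl ⟨hω, ht⟩
    · right
      obtain ⟨⟨x, hxO, hvx⟩, hLv⟩ := hω
      have hvx' : (openGraph ω).Reachable v x := hvx
      -- `v` is not joined to `t`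
      have hvt : ¬ (openGraph ω).Reachable v t := by
        intro h
        apply ht
        simp only [hRt, mem_setOf_eq]
        rw [← filter_openConn_eq_of_reachable A h]
        exact hLv
      -- hence `x = o'` and `v ↔ p`
      have hxo' : x = o' := by
        simp only [hO, Finset.mem_insert, Finset.mem_singleton] at hxO
        rcases hxO with rfl | rfl
        · exact absurd (hvx'.trans (hreach_ot ω hg)) hvt
        · rfl
      subst hxo'
      have hvp : (openGraph ω).Reachable v p := hvx'.trans (hreach_op ω hg)
      have hpv : ω ∈ (openConn p v : Set (BondConfig (Fin n))) := hvp.symm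
      refine ⟨?_, hpv, ?_, ht⟩
      · -- `p ↮ t`
        intro h
        exact hvt (hvp.trans h)
      · -- `|π(p)| ≤ j`
        simp only [hRp, mem_setOf_eq]
        rw [← filter_openConn_eq_of_reachable A hvp]
        exact hLv
  -- (3) `Room ∩ G ⊆ Rt`, disjoint from `X₁` and from `X₂`
  have hRoomRt : Room ∩ G ⊆ Rt := fun ω hω => hω.1.2.2.1
  have hRoomX1 : ∀ ω ∈ Room ∩ G, ω ∉ X₁ := by
    rintro ω ⟨⟨-, hpv, -⟩, hg⟩ hX
    obtain ⟨hnot, -⟩ := hX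
    have hvp : (openGraph ω).Reachable v p := (show (openGraph ω).Reachable p v from hpv).symm
    exact hnot o' (by simp [hO]) (hvp.trans (hreach_op ω hg).symm)
  have hRoomX2 : ∀ ω ∈ Room ∩ G, ω ∉ X₂ := by
    rintro ω ⟨⟨-, hpv, -, hnp⟩, -⟩ hX
    obtain ⟨-, hLv⟩ := hX
    apply hnp
    have hvp : (openGraph ω).Reachable v p := (show (openGraph ω).Reachable p v from hpv).symm
    simp only [hRp, mem_setOf_eq]
    rw [← filter_openConn_eq_of_reachable A hvp]
    exact hLv
  have hX12 : ∀ ω ∈ X₁, ω ∉ X₂ := by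
    rintro ω ⟨hnot, -⟩ ⟨⟨x, hx, hvx⟩, -⟩
    exact hnot x hx hvx
  -- (4) measure bookkeeping: the three disjoint pieces of `Rt`
  have hU : μ.real (Rt ∩ X₁) + μ.real (X₂ ∩ Rt) + μ.real (Room ∩ G) ≤ μ.real Rt := by
    have hd1 : Disjoint (Rt ∩ X₁) (X₂ ∩ Rt) := by
      rw [Set.disjoint_left]; rintro ω ⟨-, h1⟩ ⟨h2, -⟩; exact hX12 ω h1 h2
    have hd2 : Disjoint (Rt ∩ X₁ ∪ X₂ ∩ Rt) (Room ∩ G) := by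
      rw [Set.disjoint_left]
      rintro ω hω hR
      rcases hω with ⟨-, h1⟩ | ⟨h2, -⟩
      · exact hRoomX1 ω hR h1
      · exact hRoomX2 ω hR h2
    have e1 : μ.real (Rt ∩ X₁ ∪ X₂ ∩ Rt) = μ.real (Rt ∩ X₁) + μ.real (X₂ ∩ Rt) := measureReal_union hd1 (hmeas _)
    have e2 : μ.real (Rt ∩ X₁ ∪ X₂ ∩ Rt ∪ Room ∩ G) = μ.real (Rt ∩ X₁ ∪ X₂ ∩ Rt) + μ.real (Room ∩ G) :=
      measureReal_union hd2 (hmeas _)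
    have hsub : Rt ∩ X₁ ∪ X₂ ∩ Rt ∪ Room ∩ G ⊆ Rt := by
      rintro ω ((⟨h, -⟩ | ⟨-, h⟩) | h)
      · exact h
      · exact h
      · exact hRoomRt h
    have h : μ.real (Rt ∩ X₁ ∪ X₂ ∩ Rt ∪ Room ∩ G) ≤ μ.real Rt := measureReal_mono hsub (measure_ne_top _ _)
    rw [e2, e1] at h
    exact h
  -- (5) the exchange
  have hex : μ.real Leak ≤ μ.real Room := coreExchange w A p t v j hpt hle
  -- assemble
  have hE1' : μ.real (X₁ ∩ G) ≤ μ.real (Rt ∩ X₁) := measureReal_mono hX1 (measure_ne_top _ _)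
  have hE1 : μ.real X₁ ≤ μ.real (Rt ∩ X₁) := (hfull X₁).trans hE1'
  have hE2' : μ.real (X₂ ∩ G) ≤ μ.real ((X₂ ∩ Rt) ∪ Leak) := measureReal_mono hX2 (measure_ne_top _ _)
  have hE2 : μ.real X₂ ≤ μ.real (X₂ ∩ Rt) + μ.real Leak :=
    ((hfull X₂).trans hE2').trans (measureReal_union_le (X₂ ∩ Rt) Leak)
  have hRoomG : μ.real Room ≤ μ.real (Room ∩ G) := hfull Room
  linarith

end HullPort

end Summit.CriticalPhenomena.PercolationContinuityZ3.Theorems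

end
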